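import Literature.IUT.HodgeTheaters.PiAvatarBaseKitTheta
import Literature.IUT.HodgeTheaters.PiAvatarEvalSections
import Literature.IUT.HodgeTheaters.KitNFSideEval
import Mathlib.CategoryTheory.Groupoid.Discrete
import HarnessLib

/-!
# [IUTchI] Ex 4.4 / Prop 6.7 at the Θ-kit: the FROZEN `MultKit`, `EvalBinder`, `KitCore` and law (γ) `KitCore.ThetaAgrees`
# INHABITED over `baseKitThetaOfData` from abc-iut-L5-t3's evaluation-section binder (D-JΘ1-2 (iv-b′), file (C))

S. Mochizuki, *Inter-universal Teichmüller theory I*, kurims manuscript (May 2020), Example 4.4 (i)(ii)(iv) pp. 106–107, Proposition 6.7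
p. 167, Definition 6.1 (i) p. 156. ([IUTchI] Ex 4.4 (i) p.106) [claim: Mochizuki2012, status: disputed] (D-0012 claim key, series status
DISPUTED — kernel definitions/theorems about abc-iut's OWN kits and binders; nothing of the series is asserted; no side taken on
[IUTchIII] Cor. 3.12).

## What this file does

Over the Π-avatar kits of design D13 the evaluation-section binder `EvalBinder` and the core agreement `KitCore` are UNINHABITED at closed
`Π_v̲` (abc-iut-w4-d054 `PiAvatarKitCoreObstruction` p456090: coset maps have only invertible endomorphisms).  Over the Θ-kit
`baseKitThetaOfData` (abc-iut-L5-t4 `PiAvatarBaseKitTheta`, ambient `ThetaAmb`) they are inhabited from abc-iut-L5-t3's binder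
`ES : ∀ v ∈ bad, EvalSectionBinder (δ v) (Gv v)` (`PiAvatarEvalSections` p456293) ALONE:
* `EvalSections.isDegOver_evalOuter` / `isDegOver_of_mem_thetaClass` — `φ^Θ_{v̲_j} = [s_j ∘ aug]` and its whole class are DEGENERATE
  outer homomorphisms (over `Inn G_F`, killing `Π_v̲ ⊓ Ker aug`), hence morphisms of `ThetaAmb`;
* `thetaFamily ES` — the `|𝔽_l|`-indexed model classes `{g : 𝒟_v̲ ⟶ 𝒟_v̲ | g degenerate, g.out ∈ thetaClass j}`; nonempty
  (`thetaFamily_nonempty`), bi-saturated under automorphisms of `𝒟_v̲` (`thetaFamily_saturated`), label-rigid (`thetaFamily_rigid`, from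
  the binder's LAW `label_rigid`);
* `multKitTheta ES : KΘ.MultKit` — the FROZEN multiplicative kit shape with `thetaPolyBad j := thetaFamily [j+1]` (mono-analytic block
  tautological, the shape of `MultKit.trivialOf`);
* `evalBinderTheta ES : KΘ.EvalBinder := (multKitTheta ES).evalBinder …` — the FROZEN binder INHABITED;
* `thetaAgrees_baseKitTheta` — law (γ) `KitCore.ThetaAgrees` for the identity dictionary `KitCore.ofKit` over the §4 datum
  `BaseThetaDatum.ofKitCore KΘ … (evalBinderTheta ES)` (abc-iut-L5-t3 `thetaAgrees_ofKit`), and its corollary `nonempty_kitCore_baseKitTheta`.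
The NF kit `N : KΘ.NFKit` and the mono-analytic binder `B` enter as displayed data exactly as in `thetaAgrees_ofKit`; `5 ≤ l`, `bad ∩ arc = ∅`,
`bad ≠ ∅` are Def 3.1 (b)(c)(e) inputs.  NON-VACUITY of everything here reduces to that of `ES` (row «EVALSECT-NV»).  PRICE IN FAITHFULNESS
as recorded in `PiAvatarThetaAmb`: print's `φ^Θ_{v̲_j}` = ALL `⟨true, t, φ⟩` with `φ ∈ thetaClass j` (any transport datum `t`).
typed ≠ inhabited ≠ proved; binder ≠ fact.
-/

noncomputable section

namespace Literature.IUT.HodgeTheaters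

open CategoryTheory

universe u v w

section ThetaSlots

variable {F : Type u} {K : Type v} {Fbar : Type w} [Field F] [NumberField F] [Field K] [NumberField K]
  [Algebra F K] [Field Fbar] [Algebra F Fbar] [Algebra K Fbar]
  {E : WeierstrassCurve F} [E.IsElliptic] {l : ℕ} {Pb : BadPlacePredicates K}
  {D : InitialThetaData F K Fbar E l Pb} {CG : D.geom.pe.CuspGalois} {hS : D.CuspClassesNormaliserStable} [Fact l.Prime]

namespace InitialThetaData

/-! ### §1. The evaluation-section classes are degenerate outer homomorphisms -/

namespace EvalSections

variable {δ : D.LocalDatum CG hS} {Gv : Subgroup (Fbar ≃ₐ[F] Fbar)} (ES : EvalSections δ Gv)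

/-- **`φ^Θ_{v̲_j} = [s_j ∘ aug]` is DEGENERATE over `G_F`**: it lies over `Inn G_F` (`isOver_evalOuter`) and kills `Π_v̲ ⊓ Ker aug`
(`evalHom_eq_one_of_aug_eq_one`). ([IUTchI] Ex 4.4 (i) p.107) [claim: Mochizuki2012, status: disputed] -/
theorem isDegOver_evalOuter (j : FlAbs l) : (ES.evalOuter j).IsDegOver D.augGF :=
  ⟨ES.isOver_evalOuter j, fun _ hx => ES.evalHom_eq_one_of_aug_eq_one j hx⟩

/-- Every member of the class `thetaClass j` (two-sided composites with automorphisms of `𝒟_v̲`) is degenerate over `G_F`.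
([IUTchI] Ex 4.4 (ii) p.107) [claim: Mochizuki2012, status: disputed] -/
theorem isDegOver_of_mem_thetaClass {j : FlAbs l} {f : OuterHom δ.H δ.H} (hf : f ∈ ES.thetaClass j) : f.IsDegOver D.augGF := by
  obtain ⟨n, m, hn, hm, rfl⟩ := hf
  exact ((OuterHom.isOver_ofConj D.augGF n _).comp_isDegOver D.augGF (ES.isDegOver_evalOuter j)).comp_isOver D.augGF
    (OuterHom.isOver_ofConj D.augGF m _)

/-- The classes are two-sided saturated under conjugation by normalising elements. ([IUTchI] Ex 4.4 (ii) p.107) [claim: Mochizuki2012, status: disputed] -/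
theorem ofConj_comp_comp_ofConj_mem_thetaClass {j : FlAbs l} {f : OuterHom δ.H δ.H} (hf : f ∈ ES.thetaClass j) {n m : D.PiC}
    (hn : n ∈ Subgroup.normalizer ((δ.H : Subgroup D.PiC) : Set D.PiC))
    (hm : m ∈ Subgroup.normalizer ((δ.H : Subgroup D.PiC) : Set D.PiC))
    (hn' : ∀ x ∈ δ.H, n⁻¹ * x * n ∈ δ.H) (hm' : ∀ x ∈ δ.H, m⁻¹ * x * m ∈ δ.H) :
    ((OuterHom.ofConj n hn').comp f).comp (OuterHom.ofConj m hm') ∈ ES.thetaClass j := by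
  obtain ⟨n₀, m₀, hn₀, hm₀, rfl⟩ := hf
  refine ⟨n * n₀, m₀ * m, Subgroup.mul_mem _ hn hn₀, Subgroup.mul_mem _ hm₀ hm, ?_⟩
  rw [← OuterHom.ofConj_comp n n₀ hn' (conj_mem_of_mem_normalizer hn₀) (conj_mem_of_mem_normalizer (Subgroup.mul_mem _ hn hn₀)),
    ← OuterHom.ofConj_comp m₀ m (conj_mem_of_mem_normalizer hm₀) hm' (conj_mem_of_mem_normalizer (Subgroup.mul_mem _ hm₀ hm))]
  simp only [OuterHom.comp_assoc]

end EvalSections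

/-! ### §2. The outer homomorphism of an automorphism of `𝒟_v̲` in the Θ-kit is a normaliser conjugation -/

variable [(D.PiXund.subgroupOf D.PiXK).Normal] (hsurj : Function.Surjective D.toFlStarGlobal)
  {V : Type} [DecidableEq V] (bad arc : Finset V) (δ : V → D.LocalDatum CG hS)

/-- The outer homomorphism of an automorphism of `𝒟_v̲` in the Θ-kit is `[h ↦ n⁻¹hn]` for some `n ∈ N(Π_v̲)` (isomorphisms are étale, and every
automorphism of `ℬ(Π_v̲)⁰` in the orbit category is `xΠ_v̲ ↦ xnΠ_v̲`, `exists_eq_autOfNormalizer`). ([IUTchI] Def 6.1 (iii) p.157) [claim: Mochizuki2012, status: disputed] -/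
theorem exists_out_hom_eq_ofConj (v : V)
    (θ : (D.baseKitThetaOfData CG hS hsurj bad arc δ).model v ≅ (D.baseKitThetaOfData CG hS hsurj bad arc δ).model v) :
    ∃ (n : D.PiC) (hn : n ∈ Subgroup.normalizer (((δ v).H : Subgroup D.PiC) : Set D.PiC)),
      θ.hom.out = OuterHom.ofConj n (EvalSections.conj_mem_of_mem_normalizer hn) := by
  obtain ⟨n, hn, he⟩ := OrbitCat.exists_eq_autOfNormalizer ((δ v).isoDown θ)
  refine ⟨n, hn, ?_⟩
  exact (θ.hom.etale_spec (ThetaAmb.deg_hom_eq_false θ)).trans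
    ((congrArg OrbitCat.toOuter (congrArg Iso.hom he)).trans (OrbitCat.toOuter_homOfElem n _))

/-! ### §3. The `|𝔽_l|`-indexed degenerate classes of the Θ-kit -/

variable {Gv : V → Subgroup (Fbar ≃ₐ[F] Fbar)} (ES : ∀ v, v ∈ bad → EvalSectionBinder (δ v) (Gv v))

/-- **The class of label `j ∈ |𝔽_l|` on the Θ-kit's model at a bad index**: the DEGENERATE endomorphisms of `𝒟_v̲` whose outer homomorphism lies in
`thetaClass j` (any transport datum). ([IUTchI] Ex 4.4 (ii) p.107) [claim: Mochizuki2012, status: disputed] -/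
def thetaFamily (v : V) (hv : v ∈ bad) (j : FlAbs l) :
    Set ((D.baseKitThetaOfData CG hS hsurj bad arc δ).model v ⟶ (D.baseKitThetaOfData CG hS hsurj bad arc δ).model v) :=
  {g | g.deg = true ∧ g.out ∈ (ES v hv).thetaClass j}

/-- Membership in `thetaFamily`, unfolded. ([IUTchI] Ex 4.4 (ii) p.107) [claim: Mochizuki2012, status: disputed] -/
theorem mem_thetaFamily_iff {v : V} {hv : v ∈ bad} {j : FlAbs l}
    {g : (D.baseKitThetaOfData CG hS hsurj bad arc δ).model v ⟶ (D.baseKitThetaOfData CG hS hsurj bad arc δ).model v} :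
    g ∈ D.thetaFamily hsurj bad arc δ ES v hv j ↔ g.deg = true ∧ g.out ∈ (ES v hv).thetaClass j :=
  Iff.rfl

/-- **Every label occurs** (Ex 4.4 (i)): `⟨true, 𝟙, φ^Θ_{v̲_j}⟩ ∈ thetaFamily j`. ([IUTchI] Ex 4.4 (i) p.107) [claim: Mochizuki2012, status: disputed] -/
theorem thetaFamily_nonempty (v : V) (hv : v ∈ bad) (j : FlAbs l) : (D.thetaFamily hsurj bad arc δ ES v hv j).Nonempty :=
  ⟨ThetaAmb.degHom (𝟙 _) ((ES v hv).evalOuter j) ((ES v hv).isDegOver_evalOuter j),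
    ⟨rfl, (ES v hv).evalOuter_mem_thetaClass j⟩⟩

/-- **Bi-saturation** (Ex 4.4 (ii) «composing with arbitrary isomorphisms»): `θ ≫ g ≫ β ∈ thetaFamily j` for automorphisms `θ`, `β` of `𝒟_v̲`.
([IUTchI] Ex 4.4 (ii) p.107) [claim: Mochizuki2012, status: disputed] -/
theorem thetaFamily_saturated (v : V) (hv : v ∈ bad) (j : FlAbs l)
    (θ β : (D.baseKitThetaOfData CG hS hsurj bad arc δ).model v ≅ (D.baseKitThetaOfData CG hS hsurj bad arc δ).model v)
    {g : (D.baseKitThetaOfData CG hS hsurj bad arc δ).model v ⟶ (D.baseKitThetaOfData CG hS hsurj bad arc δ).model v}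
    (hg : g ∈ D.thetaFamily hsurj bad arc δ ES v hv j) : θ.hom ≫ g ≫ β.hom ∈ D.thetaFamily hsurj bad arc δ ES v hv j := by
  refine ⟨?_, ?_⟩
  · have hdeg : (θ.hom ≫ g ≫ β.hom).deg = (θ.hom.deg || (g.deg || β.hom.deg)) := rfl
    rw [hdeg, hg.1, Bool.true_or, Bool.or_true]
  · obtain ⟨n, hn, hθ⟩ := D.exists_out_hom_eq_ofConj hsurj bad arc δ v θ
    obtain ⟨m, hm, hβ⟩ := D.exists_out_hom_eq_ofConj hsurj bad arc δ v β
    have hout : (θ.hom ≫ g ≫ β.hom).out = (θ.hom.out.comp g.out).comp β.hom.out := (OuterHom.comp_assoc _ _ _).symm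
    rw [hout, hθ, hβ]
    exact (ES v hv).ofConj_comp_comp_ofConj_mem_thetaClass hg.2 hn hm _ _

/-- **Label rigidity** (Ex 4.4 (iv)) on the Θ-kit: if `g ∈ thetaFamily j` and `θ ≫ g ≫ β ∈ thetaFamily j′` then `j = j′` — from the binder's LAW
`label_rigid`. ([IUTchI] Ex 4.4 (iv) p.107) [claim: Mochizuki2012, status: disputed] -/
theorem thetaFamily_rigid (v : V) (hv : v ∈ bad) {j j' : FlAbs l}
    {g g' : (D.baseKitThetaOfData CG hS hsurj bad arc δ).model v ⟶ (D.baseKitThetaOfData CG hS hsurj bad arc δ).model v}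
    (θ β : (D.baseKitThetaOfData CG hS hsurj bad arc δ).model v ≅ (D.baseKitThetaOfData CG hS hsurj bad arc δ).model v)
    (hg : g ∈ D.thetaFamily hsurj bad arc δ ES v hv j) (hg' : g' ∈ D.thetaFamily hsurj bad arc δ ES v hv j')
    (h : g' = θ.hom ≫ g ≫ β.hom) : j = j' := by
  have h1 : g' ∈ D.thetaFamily hsurj bad arc δ ES v hv j := h ▸ D.thetaFamily_saturated hsurj bad arc δ ES v hv j θ β hg
  exact (ES v hv).label_rigid j j' ⟨g'.out, h1.2, hg'.2⟩

/-! ### §4. The FROZEN `MultKit` and `EvalBinder` shapes, inhabited -/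

/-- **The multiplicative (§4-input) kit of the Θ-kit generated by the evaluation sections**: `φ^Θ_{v̲_j} := thetaFamily [j+1]` at the bad indices
(the FROZEN field `MultKit.thetaPolyBad`, typed in `Amb v` = `ThetaAmb`); the mono-analytic block is the tautological one-object groupoid
(shape of `MultKit.trivialOf`; Def 4.1 (iv) plumbing only). ([IUTchI] Prop 6.7 p.167) [claim: Mochizuki2012, status: disputed] -/
def multKitTheta : (D.baseKitThetaOfData CG hS hsurj bad arc δ).MultKit where
  DMono := Discrete PUnit.{w + 1}
  mono _ := ⟨PUnit.unit⟩
  monoMap _ := 𝟙 _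
  thetaPolyBad j v hv := D.thetaFamily hsurj bad arc δ ES v hv (FlStar.toFlAbs l (FlStar.ofFin l j))

/-- `thetaPolyBad` of the Θ-kit's multiplicative kit, unfolded (definitional). ([IUTchI] Ex 4.4 (i) p.107) [claim: Mochizuki2012, status: disputed] -/
theorem multKitTheta_thetaPolyBad (j : Fin (lStar l)) (v : V) (hv : v ∈ bad) :
    (D.multKitTheta hsurj bad arc δ ES).thetaPolyBad j v hv = D.thetaFamily hsurj bad arc δ ES v hv (FlStar.toFlAbs l (FlStar.ofFin l j)) :=
  rfl

/-- **The zero-labelled class** supplied to `polyOfLabel`: `thetaFamily 0`. ([IUTchI] Ex 4.4 (i) p.107) [claim: Mochizuki2012, status: disputed] -/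
def zeroSlotTheta (v : V) (hv : v ∈ bad) :
    Set ((D.baseKitThetaOfData CG hS hsurj bad arc δ).model v ⟶ (D.baseKitThetaOfData CG hS hsurj bad arc δ).model v) :=
  D.thetaFamily hsurj bad arc δ ES v hv (FlAbs.zero l)

variable (hl5 : 5 ≤ l)

/-- The `|𝔽_l|`-indexed family assembled by `polyOfLabel` from `multKitTheta` and `zeroSlotTheta` IS `thetaFamily`.
([IUTchI] Ex 4.4 (i) p.107) [claim: Mochizuki2012, status: disputed] -/
theorem polyOfLabel_multKitTheta (v : V) (hv : v ∈ bad) (j : FlAbs l) :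
    (D.multKitTheta hsurj bad arc δ ES).polyOfLabel hl5 (D.zeroSlotTheta hsurj bad arc δ ES) v hv j =
      D.thetaFamily hsurj bad arc δ ES v hv j := by
  obtain ⟨o, rfl⟩ : ∃ o, j = (flAbsEquivOption l).symm o := ⟨flAbsEquivOption l j, by simp⟩
  cases o with
  | none =>
    change (D.multKitTheta hsurj bad arc δ ES).polyOfLabel hl5 (D.zeroSlotTheta hsurj bad arc δ ES) v hv (FlAbs.zero l) = _
    rw [PMBaseKit.MultKit.polyOfLabel_zero]
    rfl
  | some s =>
    change (D.multKitTheta hsurj bad arc δ ES).polyOfLabel hl5 (D.zeroSlotTheta hsurj bad arc δ ES) v hv (FlStar.toFlAbs l s) =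
      D.thetaFamily hsurj bad arc δ ES v hv (FlStar.toFlAbs l s)
    obtain ⟨i, rfl⟩ := (FlStar.ofFin_bijective l (PMBaseKit.MultKit.two_ne_of_five_le hl5)).2 s
    rw [PMBaseKit.MultKit.polyOfLabel_ofFin]
    rfl

/-- Input `hne` of `MultKit.evalBinder`: every class is nonempty. ([IUTchI] Ex 4.4 (i) p.107) [claim: Mochizuki2012, status: disputed] -/
theorem hne_multKitTheta (v : V) (hv : v ∈ bad) (j : FlAbs l) :
    ((D.multKitTheta hsurj bad arc δ ES).polyOfLabel hl5 (D.zeroSlotTheta hsurj bad arc δ ES) v hv j).Nonempty := by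
  rw [D.polyOfLabel_multKitTheta hsurj bad arc δ ES hl5]
  exact D.thetaFamily_nonempty hsurj bad arc δ ES v hv j

/-- Input `hrig` of `MultKit.evalBinder`: the labels are rigid. ([IUTchI] Ex 4.4 (iv) p.107) [claim: Mochizuki2012, status: disputed] -/
theorem hrig_multKitTheta (v : V) (hv : v ∈ bad) {j j' : FlAbs l}
    {g g' : (D.baseKitThetaOfData CG hS hsurj bad arc δ).model v ⟶ (D.baseKitThetaOfData CG hS hsurj bad arc δ).model v}
    (θ β : (D.baseKitThetaOfData CG hS hsurj bad arc δ).model v ≅ (D.baseKitThetaOfData CG hS hsurj bad arc δ).model v)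
    (hg : g ∈ (D.multKitTheta hsurj bad arc δ ES).polyOfLabel hl5 (D.zeroSlotTheta hsurj bad arc δ ES) v hv j)
    (hg' : g' ∈ (D.multKitTheta hsurj bad arc δ ES).polyOfLabel hl5 (D.zeroSlotTheta hsurj bad arc δ ES) v hv j')
    (h : g' = θ.hom ≫ g ≫ β.hom) : j = j' := by
  rw [D.polyOfLabel_multKitTheta hsurj bad arc δ ES hl5] at hg hg'
  exact D.thetaFamily_rigid hsurj bad arc δ ES v hv θ β hg hg' h

/-- Input `hsat` of `thetaAgrees_ofKit`: the kit's `φ^Θ_{v̲_j}` are bi-saturated. ([IUTchI] Ex 4.4 (ii) p.107) [claim: Mochizuki2012, status: disputed] -/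
theorem hsat_multKitTheta (v : V) (hv : v ∈ bad) (j : Fin (lStar l))
    (θ β : (D.baseKitThetaOfData CG hS hsurj bad arc δ).model v ≅ (D.baseKitThetaOfData CG hS hsurj bad arc δ).model v)
    {g : (D.baseKitThetaOfData CG hS hsurj bad arc δ).model v ⟶ (D.baseKitThetaOfData CG hS hsurj bad arc δ).model v}
    (hg : g ∈ (D.multKitTheta hsurj bad arc δ ES).thetaPolyBad j v hv) :
    θ.hom ≫ g ≫ β.hom ∈ (D.multKitTheta hsurj bad arc δ ES).thetaPolyBad j v hv :=
  D.thetaFamily_saturated hsurj bad arc δ ES v hv _ θ β hg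

/-- **THE FROZEN EVALUATION-SECTION BINDER `EvalBinder`, INHABITED over the Θ-kit** — generated by the evaluation sections through the frozen
constructor `MultKit.evalBinder` (Example 4.4 (i)(ii)(iv)); compare `isEmpty_evalBinder_baseKitOfData_of_isClosed` (p456090) at the D13 kits.
([IUTchI] Ex 4.4 (i) p.106) [claim: Mochizuki2012, status: disputed] -/
def evalBinderTheta : (D.baseKitThetaOfData CG hS hsurj bad arc δ).EvalBinder :=
  (D.multKitTheta hsurj bad arc δ ES).evalBinder hl5 (D.zeroSlotTheta hsurj bad arc δ ES)
    (D.hne_multKitTheta hsurj bad arc δ ES hl5) (fun v hv _ _ _ _ θ β hg hg' h => D.hrig_multKitTheta hsurj bad arc δ ES hl5 v hv θ β hg hg' h)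

include ES hl5 in
/-- NV: the frozen binder over the Θ-kit is NONEMPTY as soon as the evaluation-section binders are given.
([IUTchI] Ex 4.4 (i) p.106) [claim: Mochizuki2012, status: disputed] -/
theorem nonempty_evalBinder_baseKitTheta : Nonempty (D.baseKitThetaOfData CG hS hsurj bad arc δ).EvalBinder :=
  ⟨D.evalBinderTheta hsurj bad arc δ ES hl5⟩

/-- The evaluation sections of the inhabited binder between the model objects are the degenerate classes (unfolded).
([IUTchI] Ex 4.4 (ii) p.107) [claim: Mochizuki2012, status: disputed] -/
theorem evalBinderTheta_isEvalSection_iff {v : V} (hv : v ∈ bad) (j : FlAbs l)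
    {X Y : (D.baseKitThetaOfData CG hS hsurj bad arc δ).LocalObj v} (f : X.obj ⟶ Y.obj) :
    (D.evalBinderTheta hsurj bad arc δ ES hl5).IsEvalSection hv j f ↔
      ∃ (a : X.obj ≅ (D.baseKitThetaOfData CG hS hsurj bad arc δ).model v) (b : (D.baseKitThetaOfData CG hS hsurj bad arc δ).model v ≅ Y.obj)
        (g : (D.baseKitThetaOfData CG hS hsurj bad arc δ).model v ⟶ (D.baseKitThetaOfData CG hS hsurj bad arc δ).model v),
        g ∈ D.thetaFamily hsurj bad arc δ ES v hv j ∧ f = a.hom ≫ g ≫ b.hom := by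
  change PMBaseKit.IsSaturatedSection _ hv j f ↔ _
  unfold PMBaseKit.IsSaturatedSection
  rw [D.polyOfLabel_multKitTheta hsurj bad arc δ ES hl5]

/-! ### §5. The FROZEN `KitCore` and law (γ) `ThetaAgrees` over the Θ-kit -/

variable (hba : ∀ x ∈ (D.baseKitThetaOfData CG hS hsurj bad arc δ).bad, x ∉ (D.baseKitThetaOfData CG hS hsurj bad arc δ).arc)
  (hb : (D.baseKitThetaOfData CG hS hsurj bad arc δ).bad.Nonempty)
  (N : (D.baseKitThetaOfData CG hS hsurj bad arc δ).NFKit) (B : (D.baseKitThetaOfData CG hS hsurj bad arc δ).MonoBinder)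

/-- **Law (γ) `KitCore.ThetaAgrees` HOLDS over the Θ-kit** for the identity dictionary `KitCore.ofKit` of the §4 datum `BaseThetaDatum.ofKitCore` built from
the Θ-kit, its NF kit `N`, a mono-analytic binder `B` and the inhabited evaluation-section binder: Prop 6.7's «the kit's `φ^Θ_{v_j}` IS Example 4.4's
`φ^Θ_{v_j}`», by abc-iut-L5-t3's `thetaAgrees_ofKit` and `hsat_multKitTheta`. NON-VACUOUS modulo the displayed data (contrast p456090 at D13).
([IUTchI] Prop 6.7 p.167) [claim: Mochizuki2012, status: disputed] -/
theorem thetaAgrees_baseKitTheta :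
    (BaseThetaDatum.KitCore.ofKit (D.baseKitThetaOfData CG hS hsurj bad arc δ) hl5 hba hb N B
        (D.evalBinderTheta hsurj bad arc δ ES hl5)).ThetaAgrees (D.multKitTheta hsurj bad arc δ ES) :=
  BaseThetaDatum.thetaAgrees_ofKit _ hl5 hba hb N B _ _ _ _ (fun v hv j θ β _ hg => D.hsat_multKitTheta hsurj bad arc δ ES v hv j θ β hg)

/-- **The FROZEN core agreement `KitCore` is INHABITED over the Θ-kit** (with the §4 datum built from it) — contrast
`isEmpty_kitCore_baseKitOfData_of_isClosed` (p456090) at the D13 kits. ([IUTchI] Def 6.1 (i) p.156) [claim: Mochizuki2012, status: disputed] -/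
theorem nonempty_kitCore_baseKitTheta :
    Nonempty ((BaseThetaDatum.ofKitCore (D.baseKitThetaOfData CG hS hsurj bad arc δ) hl5 hba hb N B
      (D.evalBinderTheta hsurj bad arc δ ES hl5)).KitCore (D.baseKitThetaOfData CG hS hsurj bad arc δ)) :=
  ⟨BaseThetaDatum.KitCore.ofKit _ hl5 hba hb N B _⟩

include ES in
/-- **There EXIST an evaluation-section binder, a core agreement and a multiplicative kit over the Θ-kit satisfying law (γ)** — the existential form
the CERT bank may cite (binders displayed: `ES`, `N`, `B`, `hl5`, `hba`, `hb`). ([IUTchI] Prop 6.7 p.167) [claim: Mochizuki2012, status: disputed] -/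
theorem exists_kitCore_thetaAgrees_baseKitTheta :
    ∃ (Ev : (D.baseKitThetaOfData CG hS hsurj bad arc δ).EvalBinder)
      (c : (BaseThetaDatum.ofKitCore (D.baseKitThetaOfData CG hS hsurj bad arc δ) hl5 hba hb N B Ev).KitCore
        (D.baseKitThetaOfData CG hS hsurj bad arc δ))
      (M : (D.baseKitThetaOfData CG hS hsurj bad arc δ).MultKit), c.ThetaAgrees M :=
  ⟨_, _, _, D.thetaAgrees_baseKitTheta hsurj bad arc δ ES hl5 hba hb N B⟩

end InitialThetaData

end ThetaSlots

end Literature.IUT.HodgeTheaters
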